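import Literature.Geometry.DiscreteGeometry.TwoShellPatterns
import Literature.MathematicalPhysics.StatisticalMechanics.Crystallization

/-!
# Route `PhononSlackCertificates`, crux `FarFieldGapR` (stmt-AtomisticToContinuum-14969), line `Sketch`:
iterated poisoning (`stub_iter`)

The abstract iteration step of the octahedral-poisoning collapse `AllBadGap → FarFieldGapR`.
HYPOTHESIS (the poisoning step, proved elsewhere in the line): every `δ`-separated configuration
`y : Fin n → ℝ³` that still has a `1/20`-good particle (`IsTwoShellGood (1/20) (47/50) 1 y k`)
admits one more particle `z`, appended as `Fin.snoc y z`, such that the new configuration is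
still `δ`-separated, has STRICTLY FEWER good particles, and has Lennard-Jones interaction energy
at most `𝓔(y) + K` (`K ≥ 0` a fixed cost).  CONCLUSION: every `δ`-separated configuration `y`
embeds (`ι : Fin n ↪ Fin M`, `y' ∘ ι = y`) into an ALL-BAD `δ`-separated configuration
`y' : Fin M → ℝ³` with `M ≤ n + #good(y)` and `𝓔(y') ≤ 𝓔(y) + K · #good(y)`.

The proof is a plain induction on (a bound for) the number of good particles; the predicate
`IsTwoShellGood` and the energy `interactionEnergy lennardJones` are treated as opaque.  No
geometry happens here.
-/

noncomputable section

open scoped BigOperators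

namespace Summit.AtomisticToContinuum.Crystallization.Theorems.PhononSlackCertificatesFarFieldGapR

open Literature.MathematicalPhysics.StatisticalMechanics Literature.Geometry.DiscreteGeometry

/-- The trivial case of the iteration: a configuration WITHOUT good particles is its own all-bad
extension (`M := n`, `y' := y`, `ι := refl`); the two numeric bounds hold because
`#good(y) ≥ 0` and `K ≥ 0`. [folklore] -/
private theorem iter_allBad {δ K : ℝ} (hK : 0 ≤ K) {n : ℕ}
    (y : Fin n → EuclideanSpace ℝ (Fin 3))
    (hsep : ∀ i j : Fin n, i ≠ j → δ ≤ dist (y i) (y j))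
    (hbad : ∀ k, ¬ IsTwoShellGood (1 / 20) (47 / 50) 1 y k) :
    ∃ (M : ℕ) (y' : Fin M → EuclideanSpace ℝ (Fin 3)) (ι : Fin n ↪ Fin M),
      (∀ k, y' (ι k) = y k) ∧
      (M : ℝ) ≤ n + Nat.card {k : Fin n // IsTwoShellGood (1 / 20) (47 / 50) 1 y k} ∧
      (∀ i j : Fin M, i ≠ j → δ ≤ dist (y' i) (y' j)) ∧
      (∀ k, ¬ IsTwoShellGood (1 / 20) (47 / 50) 1 y' k) ∧
      interactionEnergy lennardJones y' ≤ interactionEnergy lennardJones y +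
        K * Nat.card {k : Fin n // IsTwoShellGood (1 / 20) (47 / 50) 1 y k} := by
  refine ⟨n, y, Function.Embedding.refl _, fun _ => rfl, ?_, hsep, hbad, ?_⟩
  · have h0 : (0 : ℝ) ≤ Nat.card {k : Fin n // IsTwoShellGood (1 / 20) (47 / 50) 1 y k} :=
      Nat.cast_nonneg _
    linarith
  · have h0 : (0 : ℝ) ≤ K * Nat.card {k : Fin n // IsTwoShellGood (1 / 20) (47 / 50) 1 y k} :=
      mul_nonneg hK (Nat.cast_nonneg _)
    linarith

/-- The iteration with an explicit BOUND `m` on the number of good particles, by induction on `m`: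
if some particle is good, apply the poisoning step once (one more particle, good count drops by at
least one, energy rises by at most `K`) and then the induction hypothesis to the extended
configuration `Fin.snoc y z : Fin (n + 1) → ℝ³`; compose the embeddings with `Fin.castSuccEmb`.
[folklore] -/
private theorem iter_bounded {δ K : ℝ} (hK : 0 ≤ K)
    (hstep : ∀ (n : ℕ) (y : Fin n → EuclideanSpace ℝ (Fin 3)),
      (∀ i j : Fin n, i ≠ j → δ ≤ dist (y i) (y j)) →
      (∃ k, IsTwoShellGood (1 / 20) (47 / 50) 1 y k) →
      ∃ z : EuclideanSpace ℝ (Fin 3),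
        (∀ i j : Fin (n + 1), i ≠ j →
          δ ≤ dist (@Fin.snoc n (fun _ => EuclideanSpace ℝ (Fin 3)) y z i)
            (@Fin.snoc n (fun _ => EuclideanSpace ℝ (Fin 3)) y z j)) ∧
        Nat.card {k : Fin (n + 1) //
            IsTwoShellGood (1 / 20) (47 / 50) 1 (@Fin.snoc n (fun _ => EuclideanSpace ℝ (Fin 3)) y z) k} <
          Nat.card {k : Fin n // IsTwoShellGood (1 / 20) (47 / 50) 1 y k} ∧
        interactionEnergy lennardJones (@Fin.snoc n (fun _ => EuclideanSpace ℝ (Fin 3)) y z) ≤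
          interactionEnergy lennardJones y + K) :
    ∀ (m n : ℕ) (y : Fin n → EuclideanSpace ℝ (Fin 3)),
      Nat.card {k : Fin n // IsTwoShellGood (1 / 20) (47 / 50) 1 y k} ≤ m →
      (∀ i j : Fin n, i ≠ j → δ ≤ dist (y i) (y j)) →
      ∃ (M : ℕ) (y' : Fin M → EuclideanSpace ℝ (Fin 3)) (ι : Fin n ↪ Fin M),
        (∀ k, y' (ι k) = y k) ∧
        (M : ℝ) ≤ n + Nat.card {k : Fin n // IsTwoShellGood (1 / 20) (47 / 50) 1 y k} ∧
        (∀ i j : Fin M, i ≠ j → δ ≤ dist (y' i) (y' j)) ∧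
        (∀ k, ¬ IsTwoShellGood (1 / 20) (47 / 50) 1 y' k) ∧
        interactionEnergy lennardJones y' ≤ interactionEnergy lennardJones y +
          K * Nat.card {k : Fin n // IsTwoShellGood (1 / 20) (47 / 50) 1 y k} := by
  intro m
  induction m with
  | zero =>
    intro n y hG hsep
    by_cases hex : ∃ k, IsTwoShellGood (1 / 20) (47 / 50) 1 y k
    · obtain ⟨z, -, hlt, -⟩ := hstep n y hsep hex
      omega
    · push Not at hex
      exact iter_allBad hK y hsep hex
  | succ m ih =>
    intro n y hG hsep
    by_cases hex : ∃ k, IsTwoShellGood (1 / 20) (47 / 50) 1 y k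
    · obtain ⟨z, hsep₁, hlt, hE₁⟩ := hstep n y hsep hex
      obtain ⟨M, y', ι₁, hι₁, hM, hsep', hbad', hE'⟩ :=
        ih (n + 1) (@Fin.snoc n (fun _ => EuclideanSpace ℝ (Fin 3)) y z) (by omega) hsep₁
      have hcast : (Nat.card {k : Fin (n + 1) //
            IsTwoShellGood (1 / 20) (47 / 50) 1
              (@Fin.snoc n (fun _ => EuclideanSpace ℝ (Fin 3)) y z) k} : ℝ) + 1 ≤
          Nat.card {k : Fin n // IsTwoShellGood (1 / 20) (47 / 50) 1 y k} := by
        exact_mod_cast hlt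
      refine ⟨M, y', Fin.castSuccEmb.trans ι₁, ?_, ?_, hsep', hbad', ?_⟩
      · intro k
        rw [Function.Embedding.trans_apply, Fin.castSuccEmb_apply, hι₁, Fin.snoc_castSucc]
      · push_cast at hM
        linarith
      · have hKG : K * (Nat.card {k : Fin (n + 1) //
            IsTwoShellGood (1 / 20) (47 / 50) 1
              (@Fin.snoc n (fun _ => EuclideanSpace ℝ (Fin 3)) y z) k} : ℝ) + K ≤
            K * Nat.card {k : Fin n // IsTwoShellGood (1 / 20) (47 / 50) 1 y k} := by
          nlinarith
        linarith
    · push Not at hex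
      exact iter_allBad hK y hsep hex

/-- **Iterated poisoning** (stub `stub_iter` of line `Sketch` for the crux `FarFieldGapR`).  From a
poisoning step at separation `δ` with cost `K ≥ 0` (hypothesis: a `δ`-separated configuration with
a good particle admits one more particle, appended with `Fin.snoc`, keeping `δ`-separation, with
strictly fewer good particles, at energy cost `≤ K`), every `δ`-separated configuration `y`
embeds into an all-bad `δ`-separated configuration `y'` with at most `#good(y)` extra particles
and energy `≤ 𝓔(y) + K · #good(y)`.  Induction on the number of good particles
(`iter_bounded` with the bound `m := #good(y)`). [folklore] -/
theorem stub_iter :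
    ∀ (δ K : ℝ), 0 ≤ K →
      (∀ (n : ℕ) (y : Fin n → EuclideanSpace ℝ (Fin 3)),
        (∀ i j : Fin n, i ≠ j → δ ≤ dist (y i) (y j)) →
        (∃ k, IsTwoShellGood (1 / 20) (47 / 50) 1 y k) →
        ∃ z : EuclideanSpace ℝ (Fin 3),
          (∀ i j : Fin (n + 1), i ≠ j →
            δ ≤ dist (@Fin.snoc n (fun _ => EuclideanSpace ℝ (Fin 3)) y z i)
              (@Fin.snoc n (fun _ => EuclideanSpace ℝ (Fin 3)) y z j)) ∧
          Nat.card {k : Fin (n + 1) //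
              IsTwoShellGood (1 / 20) (47 / 50) 1 (@Fin.snoc n (fun _ => EuclideanSpace ℝ (Fin 3)) y z) k} <
            Nat.card {k : Fin n // IsTwoShellGood (1 / 20) (47 / 50) 1 y k} ∧
          interactionEnergy lennardJones (@Fin.snoc n (fun _ => EuclideanSpace ℝ (Fin 3)) y z) ≤
            interactionEnergy lennardJones y + K) →
      ∀ (n : ℕ) (y : Fin n → EuclideanSpace ℝ (Fin 3)),
        (∀ i j : Fin n, i ≠ j → δ ≤ dist (y i) (y j)) →
        ∃ (M : ℕ) (y' : Fin M → EuclideanSpace ℝ (Fin 3)) (ι : Fin n ↪ Fin M),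
          (∀ k, y' (ι k) = y k) ∧
          (M : ℝ) ≤ n + Nat.card {k : Fin n // IsTwoShellGood (1 / 20) (47 / 50) 1 y k} ∧
          (∀ i j : Fin M, i ≠ j → δ ≤ dist (y' i) (y' j)) ∧
          (∀ k, ¬ IsTwoShellGood (1 / 20) (47 / 50) 1 y' k) ∧
          interactionEnergy lennardJones y' ≤ interactionEnergy lennardJones y +
            K * Nat.card {k : Fin n // IsTwoShellGood (1 / 20) (47 / 50) 1 y k} := by
  intro δ K hK hstep n y hsep
  exact iter_bounded hK hstep _ n y le_rfl hsep

end Summit.AtomisticToContinuum.Crystallization.Theorems.PhononSlackCertificatesFarFieldGapR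

end
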